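import Summits.QuantumFields.YangMills.Theorems.LuscherReductionTwistedTraceScalingBOStiffFarPairs
import Summits.QuantumFields.YangMills.Theorems.LuscherReductionTwistedTraceScalingBOStiffTransportTail
import HarnessLib

/-!
# (B-ST) stub (L-1b), kernel level: the based kernel of a FAR slow pair is exponentially small — `∫ K_β(U, V^{bE h}) dh ≤ e^{2β|E|}·e^{−β m²/L}`
# (lane A of S-BASE, crux `TwistedTraceScaling` stmt-QuantumFields-20203, C4-CORE, the (B-ST) pen; HANDOFF-g21 UPDATE 20:05Z)

Corollary of ✓ `…BOStiffFarPairs.kinDefect_ge_based_far` and `transferKernel_gaugeTransform_le`: for tube points `U = orthoTube u v`, `V = orthoTube u' v'` with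
`m = L(1 − (L−1)δ)‖q(u_k) − q(u'_k)‖ − L√2(‖v̂‖ + ‖v̂'‖) ≥ 0`,
★★ `transferKernel_based_far_le` — `K_β(U, V^{basedExt h}) ≤ exp(2β|E| − β m²/L)` for EVERY based `h`; ★★★ `integral_basedKernel_far_le` — the based kernel
`∫ K_β(U, V^{basedExt h}) dh ≤ exp(2β|E|)·exp(−β m²/L)`.  Together with ✓ `…BOStiffTransportTail.integral_basedKernel_off_core_le` (near pairs, off-core part) this is the
additive `τ` of `…BOStiffSlowAssembly.form_le_of_product_near` on all slow pairs.
HONEST FRAMING: bookkeeping for a stub of a child of the CONDITIONAL route R2b1; (B-ST) OPEN; C4-CORE OPEN; not infinite volume, not a gap, not Clay.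
-/

set_option autoImplicit false

noncomputable section

open MeasureTheory

namespace Summit.QuantumFields.YangMills.Theorems.FemtoTransferGap.TwoLattice.ConstTube

open Literature.MathematicalPhysics.QuantumFieldTheory Literature.MathematicalPhysics.QuantumLattice TwoLattice.Avg
open Literature.MathematicalPhysics.QuantumFieldTheory.Balaban1983to89.T4HaarSU2Translate

variable {L : ℕ} [NeZero L]

/-- ★★ **Pointwise far-pair kernel bound** against every based field. [cite: Luscher1983, §3] -/
theorem transferKernel_based_far_le {β : ℝ} (hβ : 0 ≤ β) (u u' : GaugeConfig 3 1 SU2) {v v' : Edge 3 L → Fin 3 → ℝ} (hv : v ∈ capBalancedSet L)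
    (hv' : v' ∈ capBalancedSet L) (h : NzSite L → SU2) (k : Fin 3) {δ : ℝ} (hδ : ‖su2Quat (u (0, k)) - 1‖ ≤ δ) (hδ' : ‖su2Quat (u' (0, k)) - 1‖ ≤ δ)
    (hm : 0 ≤ L * (1 - (L - 1) * δ) * ‖su2Quat (u (0, k)) - su2Quat (u' (0, k))‖ - L * (Real.sqrt 2 * (‖linkEmbed L v‖ + ‖linkEmbed L v'‖))) :
    transferKernel su2Rep β (orthoTube L u v) (gaugeTransform (basedExt L h) (orthoTube L u' v')) ≤
      Real.exp (β * (2 * (Fintype.card (Edge 3 L) : ℝ)) -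
        β * ((L * (1 - (L - 1) * δ) * ‖su2Quat (u (0, k)) - su2Quat (u' (0, k))‖ - L * (Real.sqrt 2 * (‖linkEmbed L v‖ + ‖linkEmbed L v'‖))) ^ 2 / L)) := by
  refine (transferKernel_gaugeTransform_le hβ _ _ (basedExt L h)).trans (Real.exp_le_exp.2 ?_)
  have hK := mul_le_mul_of_nonneg_left (kinDefect_ge_based_far u u' hv hv' h k hδ hδ' hm) hβ
  linarith

/-- ★★★ **The based kernel of a far slow pair**: `∫ K_β(U, V^{basedExt h}) dh ≤ exp(2β|E|)·exp(−β m²/L)`. [cite: Luscher1983, §3] -/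
theorem integral_basedKernel_far_le {β : ℝ} (hβ : 0 ≤ β) (u u' : GaugeConfig 3 1 SU2) {v v' : Edge 3 L → Fin 3 → ℝ} (hv : v ∈ capBalancedSet L)
    (hv' : v' ∈ capBalancedSet L) (k : Fin 3) {δ : ℝ} (hδ : ‖su2Quat (u (0, k)) - 1‖ ≤ δ) (hδ' : ‖su2Quat (u' (0, k)) - 1‖ ≤ δ)
    (hm : 0 ≤ L * (1 - (L - 1) * δ) * ‖su2Quat (u (0, k)) - su2Quat (u' (0, k))‖ - L * (Real.sqrt 2 * (‖linkEmbed L v‖ + ‖linkEmbed L v'‖))) :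
    ∫ h, transferKernel su2Rep β (orthoTube L u v) (gaugeTransform (basedExt L h) (orthoTube L u' v')) ∂basedMeasure L ≤
      Real.exp (β * (2 * (Fintype.card (Edge 3 L) : ℝ))) *
        Real.exp (-(β * ((L * (1 - (L - 1) * δ) * ‖su2Quat (u (0, k)) - su2Quat (u' (0, k))‖ - L * (Real.sqrt 2 * (‖linkEmbed L v‖ + ‖linkEmbed L v'‖))) ^ 2 / L))) := by
  haveI : IsProbabilityMeasure (basedMeasure L) := by infer_instance
  set B := Real.exp (β * (2 * (Fintype.card (Edge 3 L) : ℝ))) *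
    Real.exp (-(β * ((L * (1 - (L - 1) * δ) * ‖su2Quat (u (0, k)) - su2Quat (u' (0, k))‖ - L * (Real.sqrt 2 * (‖linkEmbed L v‖ + ‖linkEmbed L v'‖))) ^ 2 / L))) with hB
  have hB' : Real.exp (β * (2 * (Fintype.card (Edge 3 L) : ℝ)) -
      β * ((L * (1 - (L - 1) * δ) * ‖su2Quat (u (0, k)) - su2Quat (u' (0, k))‖ - L * (Real.sqrt 2 * (‖linkEmbed L v‖ + ‖linkEmbed L v'‖))) ^ 2 / L)) = B := by
    rw [hB, ← Real.exp_add]; ring_nf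
  have hpt : ∀ h : NzSite L → SU2, transferKernel su2Rep β (orthoTube L u v) (gaugeTransform (basedExt L h) (orthoTube L u' v')) ≤ B := fun h => by
    rw [← hB']; exact transferKernel_based_far_le hβ u u' hv hv' h k hδ hδ' hm
  have h0 : ∀ h : NzSite L → SU2, 0 ≤ transferKernel su2Rep β (orthoTube L u v) (gaugeTransform (basedExt L h) (orthoTube L u' v')) :=
    fun h => (transferKernel_pos su2Rep β _ _).le
  have hmono := integral_mono_of_nonneg (μ := basedMeasure L) (ae_of_all _ h0) (integrable_const B) (ae_of_all _ hpt)
  simpa [integral_const] using hmono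

end Summit.QuantumFields.YangMills.Theorems.FemtoTransferGap.TwoLattice.ConstTube

end
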